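import Summits.ResolutionOfSingularities.ResolutionOfSingularities.Theorems.HomologicalConductorNoZenoNodeCurveRegular
import Summits.ResolutionOfSingularities.ResolutionOfSingularities.Theorems.HomologicalConductorNoZenoH0Point
import HarnessLib

/-!
# Crux `NoZenoR` (stmt-ResolutionOfSingularities-19943), slot 5 `stub_L1wCoreF3`, ROUTE M (m2):
# THE NODE-CURVE PACKAGE ON THE GERM RESOLUTION — first kind AND regular, by name

OURS (cell res-hironaka, crux chain W4.4, seat res-L0-w44-stub-1 g12). Nothing here is a statement of the manuscript
under review (Hironaka 2017); AI-written, weaker than expert review. Def-free, fact-free, `--supports 19943 --as helper`.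

One theorem assembling this seat's UP-5 files into the two hypotheses the lead's ROUTE M step (m2) consumes for a node
curve of the GERM resolution (`…StrictTransformCaseA.caseA_of_firstKind`: first kind; `…CaseARegular.forall_…_of_caseA`:
`hreg`), in the currency of res-L0-w44-stub-3's `exists_chartGermResolution` (chart `σ : U → Spec N` on an open
`U ⊆ X¹` over the base, `𝔮 ⊂ N` maximal, `N' = N_𝔮`, `g = Spec(N → N')`, germ resolution `ψ = pullback.snd σ g`,
`fst = pullback.fst σ g`):

* `comap_eq_maximalIdeal_of_over` — `𝔮.comap φ = 𝔪_S` as soon as some point of `U` over `𝔮` lies over the closed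
  point of `S` (the local-homomorphism hypothesis of `…FirstKindGerm`).
* **`node_curve_germ_package`** — for the blow-up `ρ : X¹ → X₀` of the reduced finite centre `Z ∋ x` (`x` isolated in
  `Z`, `𝒪_{X₀,x}` regular of dimension `2`, `X₀` regular, finite residue degree at `x`) and a point `ζ` of the germ
  `U ×_N Spec N'` whose image in `X¹` is the generic point of the node curve `ρ⁻¹{x} ⊆ U`:
  `h0 ψ (𝓘_ζ ^ 2) = 3 * h0 ψ 𝓘_ζ` (FIRST KIND over the germ) and `∀ w, ζ ⤳ w → ¬ (𝓘_ζ)_w ≤ 𝔪_w²` (REGULAR).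
  Inputs by name: `PointBlowup.h0_comap_vanishingIdeal_node` (p564336), `…exists_primeDivisorIdeal_eq_comap_vanishingIdeal_node`
  and `…not_stalkIdeal_primeDivisorIdeal_le_sq_node` (`…NodeCurveRegular`), `h0_vanishingIdeal_singleton_eq_residueDegree`
  (`…H0Point`), `h0_primeDivisorIdeal_sq_eq_three_mul_of_fst_of_openImmersion` (`…FirstKindGerm`), and the two transport
  equivalences of `…NodeCurveRegular`.

References: J. Lipman, Publ. Math. IHÉS 36 (1969) §27 (27.1) [`Lipman1969`] (context); Q. Liu (2002) Thm. 8.1.19 [`Liu2002`].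
-/

noncomputable section

-- single-problem summit: the doubled namespace component `ResolutionOfSingularities` is forced
set_option linter.dupNamespace false

namespace Summit.ResolutionOfSingularities.ResolutionOfSingularities.Theorems.NoZeno.ExcCount

open CategoryTheory AlgebraicGeometry Limits TopologicalSpace Topology Opposite IsLocalRing
open Literature.AlgebraicGeometry.Morphisms Literature.AlgebraicGeometry.Resolution
open Scheme.IdealSheafData

/-- **`𝔮` lies over `𝔪_S`.** If `σ : U → Spec N` sits over `π : U → Spec S` (`σ ≫ Spec φ = π`, `S` local) and some
point `z ∈ U` maps to `𝔮` under `σ` and to the closed point under `π`, then `𝔮.comap φ = 𝔪_S` — the hypothesis `h𝔮`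
of `…FirstKindGerm.h0_primeDivisorIdeal_sq_eq_three_mul_of_fst`. [folklore] -/
theorem comap_eq_maximalIdeal_of_over {S N : Type} [CommRing S] [IsLocalRing S] [CommRing N] (φ : S →+* N)
    {U : Scheme.{0}} (π : U ⟶ Spec (.of S)) (σ : U ⟶ Spec (.of N))
    (hσ : σ ≫ Spec.map (CommRingCat.ofHom φ) = π) (𝔮 : Ideal N) [𝔮.IsPrime] {z : U}
    (hz : σ.base z = ⟨𝔮, inferInstance⟩) (hzπ : π.base z = closedPoint S) : 𝔮.comap φ = maximalIdeal S := by
  have h1 : (Spec.map (CommRingCat.ofHom φ)).base (σ.base z) = closedPoint S := by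
    rw [← Scheme.Hom.comp_apply, hσ]; exact hzπ
  rw [hz] at h1
  have h2 := congrArg PrimeSpectrum.asIdeal h1
  exact h2

/-- **THE NODE-CURVE PACKAGE ON THE GERM RESOLUTION.** Setting: `π₀ : X₀ → Spec S` (`S` local; `X₀` regular, locally
Noetherian), `ρ : X1 → X₀` a blowing up of the reduced ideal of a closed `Z ⊆ X₀`, `x ∈ Z` a closed point isolated in `Z`
(`Z ∩ U₀ = {x}`) over the closed point, with `𝒪_{X₀,x}` regular of dimension `2` and finite residue degree; a chart
`σ : U → Spec N` on an open `U ⊆ X1` over `Spec S` (`σ ≫ Spec φ = U.ι ≫ ρ ≫ π₀`), `𝔮 ⊂ N` maximal, `N' = N_𝔮`,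
`g = Spec(N → N')`; and a point `ζ` of the germ `U ×_N Spec N'` with `σ (fst ζ) = 𝔮` whose image in `X1` has closure the
whole node curve `ρ⁻¹{x}`, itself inside `U`. CONCLUSION: the curve `cl{ζ}` of the germ resolution
`ψ = pullback.snd σ g` is OF THE FIRST KIND, `h0 ψ (𝓘_ζ ^ 2) = 3 * h0 ψ 𝓘_ζ`, and REGULAR,
`∀ w, ζ ⤳ w → ¬ (𝓘_ζ)_w ≤ 𝔪_w ^ 2` — the two (m2) inputs of ROUTE M for node curves. [this work] -/
theorem node_curve_germ_package
    {S : Type} [CommRing S] [IsLocalRing S] {X₀ X1 : Scheme.{0}} [IsLocallyNoetherian X₀] [IsLocallyNoetherian X1]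
    [IsIntegral X1] (π₀ : X₀ ⟶ Spec (.of S)) (hX₀ : Scheme.IsRegular X₀) (Z : Closeds X₀) {ρ : X1 ⟶ X₀}
    (hρ : IsBlowup ρ (vanishingIdeal Z)) (x : X₀) (hx : IsClosed ({x} : Set X₀)) (U₀ : X₀.Opens) (hxU₀ : x ∈ U₀)
    (hZU : (Z : Set X₀) ∩ U₀ = {x}) (hdim : ringKrullDim (X₀.presheaf.stalk x) = 2)
    (hπx : π₀.base x = closedPoint S) (hdeg : π₀.residueDegree x ≠ 0)
    {N N' : Type} [CommRing N] [CommRing N'] [Algebra N N'] (𝔮 : Ideal N) [𝔮.IsMaximal]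
    [IsLocalization.AtPrime N' 𝔮] [IsLocalRing N'] (φ : S →+* N)
    (U : X1.Opens) (σ : (U : Scheme.{0}) ⟶ Spec (.of N))
    (hσ : σ ≫ Spec.map (CommRingCat.ofHom φ) = U.ι ≫ ρ ≫ π₀)
    (ζ : ↑(pullback σ (Spec.map (CommRingCat.ofHom (algebraMap N N')))))
    (hζ : σ.base ((pullback.fst σ (Spec.map (CommRingCat.ofHom (algebraMap N N')))).base ζ) =
      ⟨𝔮, inferInstance⟩)
    (hζx : closure {U.ι.base ((pullback.fst σ (Spec.map (CommRingCat.ofHom (algebraMap N N')))).base ζ)} =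
      ρ.base ⁻¹' {x})
    (hxU : ρ.base ⁻¹' {x} ⊆ (U : Set X1)) :
    h0 (pullback.snd σ (Spec.map (CommRingCat.ofHom (algebraMap N N')))) (primeDivisorIdeal ζ ^ 2) =
        3 * h0 (pullback.snd σ (Spec.map (CommRingCat.ofHom (algebraMap N N')))) (primeDivisorIdeal ζ) ∧
      ∀ w : ↑(pullback σ (Spec.map (CommRingCat.ofHom (algebraMap N N')))), ζ ⤳ w →
        ¬ stalkIdeal (primeDivisorIdeal ζ) w ≤
          maximalIdeal ((pullback σ (Spec.map (CommRingCat.ofHom (algebraMap N N')))).presheaf.stalk w) ^ 2 := by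
  haveI : IsRegularLocalRing (X₀.presheaf.stalk x) := hX₀ x
  -- the node curve `η` of `x` on `X1` and its ideal
  have hne : maximalIdeal (X₀.presheaf.stalk x) ≠ ⊥ := by
    intro hbot
    have hf : IsField (X₀.presheaf.stalk x) := (isField_iff_maximalIdeal_eq).mpr hbot
    have h0 := ringKrullDim_eq_zero_of_isField hf
    rw [hdim] at h0
    exact absurd h0 (by decide)
  obtain ⟨η, hηcl, hη⟩ :=
    PointBlowup.exists_primeDivisorIdeal_eq_comap_vanishingIdeal_node hX₀ Z hρ x hx U₀ hxU₀ hZU hne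
  -- `η` is the image of `fst ζ` (same closure, `X1` is T₀)
  set z := (pullback.fst σ (Spec.map (CommRingCat.ofHom (algebraMap N N')))).base ζ with hz
  have hηz : η = U.ι.base z := by
    have : closure ({η} : Set X1) = closure {U.ι.base z} := by rw [hηcl, hζx]
    exact (inseparable_iff_closure_eq.mpr this).eq
  -- the point `x` sits over the closed point, `𝔮` over `𝔪_S`
  have hzx : ρ.base (U.ι.base z) = x := by
    have : U.ι.base z ∈ ρ.base ⁻¹' {x} := by rw [← hζx]; exact subset_closure rfl
    exact this
  have h𝔮 : 𝔮.comap φ = maximalIdeal S :=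
    comap_eq_maximalIdeal_of_over φ (U.ι ≫ ρ ≫ π₀) σ hσ 𝔮 hζ
      (by rw [Scheme.Hom.comp_apply, Scheme.Hom.comp_apply, hzx]; exact hπx)
  -- FIRST KIND on `X1` over `S` (UP-5 at a node), in prime-divisor currency
  have hnode := PointBlowup.h0_comap_vanishingIdeal_node π₀ ρ Z hρ x hx U₀ hxU₀ hZU hdim
  have hfk : h0 (ρ ≫ π₀) (primeDivisorIdeal (U.ι.base z) ^ 2) = 3 * h0 (ρ ≫ π₀) (primeDivisorIdeal (U.ι.base z)) := by
    rw [← hηz, hη, hnode.1, hnode.2]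
  have hfin : h0 (ρ ≫ π₀) (primeDivisorIdeal (U.ι.base z)) ≠ ⊤ := by
    rw [← hηz, hη, hnode.1, h0_vanishingIdeal_singleton_eq_residueDegree π₀ x hx hπx hdeg]
    exact ENat.coe_ne_top _
  have hcl : closure {U.ι.base z} ⊆ (U : Set X1) := by rw [hζx]; exact hxU
  refine ⟨?_, ?_⟩
  · have hσ' : σ ≫ Spec.map (CommRingCat.ofHom φ) = U.ι ≫ (ρ ≫ π₀) := hσ
    exact h0_primeDivisorIdeal_sq_eq_three_mul_of_fst_of_openImmersion 𝔮 φ h𝔮 (ρ ≫ π₀) U σ hσ' ζ hζ hcl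
      hfk hfin
  · intro w hw
    -- REGULAR on `X1`, moved to `U` and to the germ
    have hzw : z ⤳ (pullback.fst σ (Spec.map (CommRingCat.ofHom (algebraMap N N')))).base w :=
      hw.map (pullback.fst σ (Spec.map (CommRingCat.ofHom (algebraMap N N')))).base.hom.continuous
    have hXw : U.ι.base z ⤳ U.ι.base ((pullback.fst σ (Spec.map (CommRingCat.ofHom (algebraMap N N')))).base w) :=
      hzw.map U.ι.base.hom.continuous
    have hη' : primeDivisorIdeal (U.ι.base z) = (vanishingIdeal ⟨{x}, hx⟩).comap ρ := by rw [← hηz, hη]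
    have k1 := PointBlowup.not_stalkIdeal_primeDivisorIdeal_le_sq_node hX₀ Z hρ x hx U₀ hxU₀ hZU hη' hXw
    have k2 := (not_stalkIdeal_primeDivisorIdeal_le_sq_iff_of_isOpenImmersion U.ι z
      ((pullback.fst σ (Spec.map (CommRingCat.ofHom (algebraMap N N')))).base w)).mpr k1
    exact (not_stalkIdeal_primeDivisorIdeal_le_sq_iff_fst 𝔮 σ hζ hw).mpr k2

end Summit.ResolutionOfSingularities.ResolutionOfSingularities.Theorems.NoZeno.ExcCount

end
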